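import Mathlib
import Literature.Analysis.FluidPDE.GaussianVortexPlanar
import Literature.Analysis.FluidPDE.GaussianVortexPlanarProofs
import Literature.Analysis.FluidPDE.BiotSavart2DSymmetry
import Literature.Analysis.FluidPDE.PlanarBiotSavartDivFree
import Literature.Analysis.FluidPDE.WholeSpaceIBP
import Summits.AnomalousDissipation.AnomalousDissipation.Theorems.MarginalStabilityChainStretchedVortexRowsStubCoreRotationLocalSkew
import Summits.AnomalousDissipation.AnomalousDissipation.Theorems.MarginalStabilityChainStretchedVortexRowsStubCoreBiotSavartSkew
import HarnessLib

/-!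
# Helper toward stub `stub_coreInverse` of the line `braid-closed-large-circulation-gluing`
# (crux stmt-AnomalousDissipation-3009, `MarginalStabilityChain.StretchedVortexRows`):
# the Biot–Savart velocity is weakly divergence-free against GAUSSIAN-CLASS test functions

The tree's `integral_inner_biotSavart2D_gradient_eq_zero` (`PlanarBiotSavartDivFree`) gives
`∫ ⟪K∗f, ∇h⟫ = 0` for compactly supported `h ∈ C¹`. The background pairings of the energy method for
`stub_coreInverse` (`lamB_pairing_w_bound`) need it for test functions of Gaussian class (`h = G u²`, `h = u₀ w_B`),
`|h| + ‖Dh‖ ≤ A(1+|x|)^k G(x)`: we remove the compact-support assumption by the smooth cut-offs `χ_R` of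
`WholeSpaceIBP` (`cutoff R`, `‖Dχ_R‖ ≤ C/R`): `0 = ∫⟪v, ∇(χ_R h)⟫ = ∫ χ_R Dh[v] + ∫ h Dχ_R[v]`, the first
term tends to `∫ Dh[v]` by dominated convergence (`v = K∗f` is bounded) and the second is `O(1/R)`
(`integral_inner_biotSavart2D_gradient_eq_zero_of_gaussClass`).
-/

set_option linter.dupNamespace false

noncomputable section

open scoped RealInnerProductSpace Topology
open MeasureTheory WithLp Function Metric Filter Set

namespace Summit.AnomalousDissipation.AnomalousDissipation.Theorems.MarginalStabilityChainStretchedVortexRows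

open Literature.Analysis.FluidPDE

/-- **Weak divergence-freeness of `K∗f` against Gaussian-class test functions**: for `f` continuous, integrable
and bounded, and `h ∈ C¹` with `|h| + ‖Dh‖ ≤ A (1+|x|)^k G`, `∫ ⟪(K∗f)(x), ∇h(x)⟫ dx = 0`. [folklore] -/
theorem integral_inner_biotSavart2D_gradient_eq_zero_of_gaussClass :
    ∀ (k : ℕ) (A B : ℝ) (f h : EuclideanSpace ℝ (Fin 2) → ℝ), Continuous f → Integrable f → (∀ y, |f y| ≤ B) →
      ContDiff ℝ 1 h → (∀ x, |h x| + ‖fderiv ℝ h x‖ ≤ A * (1 + ‖x‖) ^ k * gaussVortexProfile x) →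
      ∫ x, ⟪biotSavart2D f x, gradient h x⟫ = 0 := by
  intro k A B f h hfc hfi hB hh hbound
  -- the velocity `v = K∗f` is bounded and measurable
  set v : EuclideanSpace ℝ (Fin 2) → EuclideanSpace ℝ (Fin 2) := biotSavart2D f with hv
  have hK : ∀ x, Integrable (fun y => f y • biotSavartKernel2D (x - y)) :=
    integrable_smul_biotSavartKernel2D hfi hB
  set I₁ : ℝ := ∫ z, Set.indicator (Metric.ball (0 : EuclideanSpace ℝ (Fin 2)) 1) (fun z => ‖z‖⁻¹) z with hI₁
  set V : ℝ := (2 * Real.pi)⁻¹ * (B * I₁ + ∫ y, |f y|) with hVdef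
  have hM : ∀ x, ∫ y, ‖f y • biotSavartKernel2D (x - y)‖ ≤ V := fun x =>
    integral_norm_smul_biotSavartKernel2D_le hfi hB hK x
  have hV : ∀ x, ‖v x‖ ≤ V := fun x => norm_biotSavart2D_le hfi hB x
  have hV0 : 0 ≤ V := (norm_nonneg _).trans (hV 0)
  have hvm : AEStronglyMeasurable v volume := (stronglyMeasurable_biotSavart2D hfc.measurable).aestronglyMeasurable
  -- basic facts about `h`
  have hGpos : ∀ x : EuclideanSpace ℝ (Fin 2), 0 < gaussVortexProfile x := gaussVortexProfile_pos
  have hA : ∀ x, 0 ≤ A * (1 + ‖x‖) ^ k * gaussVortexProfile x := fun x =>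
    le_trans (by positivity) (hbound x)
  have hhc : Continuous h := hh.continuous
  have hgc : Continuous (gradient h) := continuous_gradient_of_contDiff hh
  have hng : ∀ x, ‖gradient h x‖ = ‖fderiv ℝ h x‖ := fun x => by
    rw [gradient, LinearIsometryEquiv.norm_map]
  have hhd : ∀ x, DifferentiableAt ℝ h x := fun x => hh.differentiable one_ne_zero x
  -- integrability of `x ↦ ⟪v x, ∇h x⟫` and of `|h|`
  have hmeas_vh : AEStronglyMeasurable (fun x => ⟪v x, gradient h x⟫) volume := hvm.inner hgc.aestronglyMeasurable
  have habs_vh : ∀ x, |⟪v x, gradient h x⟫| ≤ A * V * ((1 + ‖x‖) ^ k * gaussVortexProfile x) := by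
    intro x
    calc |⟪v x, gradient h x⟫| ≤ ‖v x‖ * ‖gradient h x‖ := abs_real_inner_le_norm _ _
      _ ≤ V * (A * (1 + ‖x‖) ^ k * gaussVortexProfile x) := by
          refine mul_le_mul (hV x) ?_ (norm_nonneg _) hV0
          rw [hng]
          exact le_trans (le_add_of_nonneg_left (abs_nonneg _)) (hbound x)
      _ = A * V * ((1 + ‖x‖) ^ k * gaussVortexProfile x) := by ring
  have hint_vh : Integrable fun x => ⟪v x, gradient h x⟫ :=
    Integrable.mono' ((integrable_one_add_norm_pow_mul_gaussVortexProfile k).const_mul (A * V)) hmeas_vh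
      (Eventually.of_forall fun x => by rw [Real.norm_eq_abs]; exact habs_vh x)
  have hint_h : Integrable fun x => |h x| := by
    refine Integrable.mono' (((integrable_one_add_norm_pow_mul_gaussVortexProfile k).const_mul A))
      hhc.abs.aestronglyMeasurable (Eventually.of_forall fun x => ?_)
    rw [Real.norm_eq_abs, abs_abs]
    calc |h x| ≤ A * (1 + ‖x‖) ^ k * gaussVortexProfile x :=
          le_trans (le_add_of_nonneg_right (norm_nonneg _)) (hbound x)
      _ = A * ((1 + ‖x‖) ^ k * gaussVortexProfile x) := by ring
  -- the cut-offs `χ_R`, `R = n + 1`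
  obtain ⟨C, hC0, hC⟩ := exists_norm_fderiv_cutoff_le (E := EuclideanSpace ℝ (Fin 2))
  have hχfacts : ∀ R : ℝ, 0 < R →
      Continuous (gradient (cutoff (E := EuclideanSpace ℝ (Fin 2)) R)) ∧
      ∀ x, |⟪v x, gradient (cutoff (E := EuclideanSpace ℝ (Fin 2)) R) x⟫| ≤ C / R * V := by
    intro R hR
    refine ⟨continuous_gradient_of_contDiff (contDiff_cutoff R), fun x => ?_⟩
    calc |⟪v x, gradient (cutoff R) x⟫| ≤ ‖v x‖ * ‖gradient (cutoff R) x‖ := abs_real_inner_le_norm _ _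
      _ ≤ V * (C / R) := by
          refine mul_le_mul (hV x) ?_ (norm_nonneg _) hV0
          rw [gradient, LinearIsometryEquiv.norm_map]
          exact hC R hR x
      _ = C / R * V := by ring
  have hstep : ∀ n : ℕ, ∫ x, cutoff ((n : ℝ) + 1) x * ⟪v x, gradient h x⟫ =
      -∫ x, h x * ⟪v x, gradient (cutoff ((n : ℝ) + 1)) x⟫ := by
    intro n
    set R : ℝ := (n : ℝ) + 1 with hR
    have hRpos : 0 < R := by rw [hR]; positivity
    obtain ⟨hgχc, hgχb⟩ := hχfacts R hRpos
    have hχ : ContDiff ℝ 1 (cutoff (E := EuclideanSpace ℝ (Fin 2)) R) := contDiff_cutoff R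
    have hχc : HasCompactSupport (cutoff (E := EuclideanSpace ℝ (Fin 2)) R) := hasCompactSupport_cutoff hRpos
    have hχh : ContDiff ℝ 1 fun x => cutoff R x * h x := hχ.mul hh
    have hχhc : HasCompactSupport fun x => cutoff R x * h x := hχc.mul_right
    have key := integral_inner_biotSavart2D_gradient_eq_zero hfi hK hM hχh hχhc
    -- `⟪v, ∇(χh)⟫ = χ ⟪v, ∇h⟫ + h ⟪v, ∇χ⟫`
    have hpt : ∀ x, ⟪v x, gradient (fun x => cutoff R x * h x) x⟫ =
        cutoff R x * ⟪v x, gradient h x⟫ + h x * ⟪v x, gradient (cutoff R) x⟫ := by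
      intro x
      rw [inner_gradient_right, inner_gradient_right, inner_gradient_right]
      simp only [RCLike.conj_to_real]
      rw [fderiv_fun_mul ((hχ.differentiable one_ne_zero) x) (hhd x)]
      simp only [_root_.add_apply, _root_.smul_apply, smul_eq_mul]
    have hint2 : Integrable fun x => h x * ⟪v x, gradient (cutoff R) x⟫ := by
      have hmeas : AEStronglyMeasurable (fun x => h x * ⟪v x, gradient (cutoff R) x⟫) volume :=
        hhc.aestronglyMeasurable.mul (hvm.inner hgχc.aestronglyMeasurable)
      refine Integrable.mono' (hint_h.const_mul (C / R * V)) hmeas (Eventually.of_forall fun x => ?_)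
      rw [Real.norm_eq_abs, abs_mul]
      calc |h x| * |⟪v x, gradient (cutoff R) x⟫| ≤ |h x| * (C / R * V) :=
            mul_le_mul_of_nonneg_left (hgχb x) (abs_nonneg _)
        _ = C / R * V * |h x| := by ring
    have hint1 : Integrable fun x => cutoff R x * ⟪v x, gradient h x⟫ := by
      refine Integrable.mono' hint_vh.norm ((contDiff_cutoff (n := 0) R).continuous.aestronglyMeasurable.mul hmeas_vh)
        (Eventually.of_forall fun x => ?_)
      rw [Real.norm_eq_abs, abs_mul, Real.norm_eq_abs]
      exact mul_le_of_le_one_left (abs_nonneg _) (abs_cutoff_le_one R x)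
    have : ∫ x, (cutoff R x * ⟪v x, gradient h x⟫ + h x * ⟪v x, gradient (cutoff R) x⟫) = 0 := by
      rw [← key]
      exact integral_congr_ae (Eventually.of_forall fun x => (hpt x).symm)
    rw [integral_add hint1 hint2] at this
    linarith
  -- the left side tends to `∫ ⟪v, ∇h⟫`, the right side to `0`
  have hlim1 : Tendsto (fun n : ℕ => ∫ x, cutoff ((n : ℝ) + 1) x * ⟪v x, gradient h x⟫) atTop
      (𝓝 (∫ x, ⟪v x, gradient h x⟫)) := by
    refine tendsto_integral_of_dominated_convergence (fun x => ‖⟪v x, gradient h x⟫‖) (fun n => ?_) hint_vh.norm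
      (fun n => Eventually.of_forall fun x => ?_) (Eventually.of_forall fun x => ?_)
    · exact (contDiff_cutoff (n := 0) _).continuous.aestronglyMeasurable.mul hmeas_vh
    · rw [norm_mul]
      exact mul_le_of_le_one_left (norm_nonneg _) (by simpa using abs_cutoff_le_one ((n : ℝ) + 1) x)
    · have := (tendsto_cutoff_natCast_add_one x).mul_const ⟪v x, gradient h x⟫
      simpa using this
  have hlim2 : Tendsto (fun n : ℕ => -∫ x, h x * ⟪v x, gradient (cutoff ((n : ℝ) + 1)) x⟫) atTop (𝓝 0) := by
    rw [← neg_zero]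
    refine Tendsto.neg ?_
    have hbd : ∀ n : ℕ, |∫ x, h x * ⟪v x, gradient (cutoff ((n : ℝ) + 1)) x⟫| ≤
        C / ((n : ℝ) + 1) * V * ∫ x, |h x| := by
      intro n
      have hRpos : 0 < (n : ℝ) + 1 := by positivity
      obtain ⟨-, hgχb⟩ := hχfacts ((n : ℝ) + 1) hRpos
      calc |∫ x, h x * ⟪v x, gradient (cutoff ((n : ℝ) + 1)) x⟫|
          ≤ ∫ x, |h x * ⟪v x, gradient (cutoff ((n : ℝ) + 1)) x⟫| := by
            simpa only [← Real.norm_eq_abs] using norm_integral_le_integral_norm _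
        _ ≤ ∫ x, C / ((n : ℝ) + 1) * V * |h x| := by
            refine integral_mono_of_nonneg (Eventually.of_forall fun x => abs_nonneg _)
              (hint_h.const_mul _) (Eventually.of_forall fun x => ?_)
            dsimp only
            rw [abs_mul]
            calc |h x| * |⟪v x, gradient (cutoff ((n : ℝ) + 1)) x⟫| ≤ |h x| * (C / ((n : ℝ) + 1) * V) :=
                  mul_le_mul_of_nonneg_left (hgχb x) (abs_nonneg _)
              _ = C / ((n : ℝ) + 1) * V * |h x| := by ring
        _ = C / ((n : ℝ) + 1) * V * ∫ x, |h x| := integral_const_mul _ _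
    have hmaj : Tendsto (fun n : ℕ => C / ((n : ℝ) + 1) * V * ∫ x, |h x|) atTop (𝓝 0) := by
      have h1 : Tendsto (fun n : ℕ => C / ((n : ℝ) + 1)) atTop (𝓝 0) :=
        tendsto_const_nhds.div_atTop (tendsto_natCast_atTop_atTop.atTop_add tendsto_const_nhds)
      simpa using (h1.mul_const V).mul_const (∫ x, |h x|)
    exact squeeze_zero_norm (fun n => by rw [Real.norm_eq_abs]; exact hbd n) hmaj
  have hEq : (fun n : ℕ => ∫ x, cutoff ((n : ℝ) + 1) x * ⟪v x, gradient h x⟫) =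
      fun n : ℕ => -∫ x, h x * ⟪v x, gradient (cutoff ((n : ℝ) + 1)) x⟫ := funext hstep
  rw [hEq] at hlim1
  exact tendsto_nhds_unique hlim1 hlim2

end Summit.AnomalousDissipation.AnomalousDissipation.Theorems.MarginalStabilityChainStretchedVortexRows

end
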